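import Summits.QuantumFields.YangMills.Theorems.DiagonalMirrorRPROddTorusSwapPairingDefs
import Literature.MathematicalPhysics.QuantumFieldTheory.GaugeOSData
import Literature.MathematicalPhysics.QuantumFieldTheory.LatticeGaugeStaticPotentialProofs
import Literature.MathematicalPhysics.QuantumLattice.GermMarkov
import Mathlib.Probability.Distributions.Gaussian.Real
import Mathlib.Probability.ProductMeasure

/-!
# Sketch — crux-ideate ⟨stmt-QuantumFields-27395⟩ `WeakCouplingHypercubicLimitRP`,
# idea `markov-mirror-hubbard-stratonovich` (gen 10, ideator k = 1)

Door **M** (Markov) for the swap socket `OddTorusSwapPairingLiminf`, plugged through door V's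
`LimitSwapRP` (`VolumeFirstIdeaSketch.stub_socket_of_limitSwapRP`).

* §1 — the ABSTRACT NELSON LEMMA, kernel-checked: a measure-preserving map `θ` that fixes the
  events of a σ-algebra `m₀` pointwise, carries `mpos`-observables to `mneg`-observables, and a state in
  which `m₀` SPLITS `mneg` and `mpos` (Markov property across the mirror, bounded-function form) give
  `0 ≤ ∫ F(θω) F(ω) dμ` for every bounded `mpos`-observable `F` — reflection positivity BY MARKOV
  (Nelson 1973; Glimm–Jaffe §6.1), with NO transfer matrix, NO second geometry, NO identification.
* §2 — the KEY IDENTITY making Wilson's diagonal site-mirror a genuine Markov cut: on unitary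
  matrices `Re tr (A Bᴴ) = N − ½‖A − B‖²_F`, so the crossing `(0,1)`-plaquette weight
  `exp(β Re tr ρ(W₊ W₋⁻¹))` is a GAUSSIAN kernel of the two half-paths `ρ(W₊)`, `ρ(W₋)` and is
  decoupled by one auxiliary Gaussian matrix per `(0,1)`-plaquette (Hubbard–Stratonovich) with ALL
  weights positive; the auxiliary variables at mirror sites are FIXED by the swap.
* §3 — the LETTER, typed: `DiagGlobalMarkov r β μ` = global Markov property of the
  Hubbard–Stratonovich extension `μ̂` of `μ` across the diagonal hyperplane `x₀ = x₁`
  (tree `CondIndepCondExp`), and the target signature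
  `stub_limitSwapRP_of_limitDiagGlobalMarkov : (∀ μ ∈ oddTorusLimitPoints r β, DiagGlobalMarkov r β μ)
  → LimitSwapRP r β` (size M: §1 + §2 + swap invariance of odd-torus limits).

Nothing here is a claim about the Yang–Mills mass gap; the two `stub_` signatures are NOT proved.
-/

set_option autoImplicit false

noncomputable section

open MeasureTheory Filter Topology ProbabilityTheory
open scoped NNReal
open Literature.MathematicalPhysics.QuantumLattice Literature.MathematicalPhysics.AQFT
  Literature.MathematicalPhysics.QuantumFieldTheory Literature.Probability.LatticeModels
namespace Summit.QuantumFields.YangMills.Cruxes.WeakCouplingHypercubicLimitRP.GlobalMarkov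

/-! ## §0 Door V's vocabulary (VERBATIM copy of `VolumeFirstIdeaSketch.lean`, gen 1, so that this
file does not import an unbuilt Cruxes module; the three definitions are `Iff.rfl`-identical to
`…WeakCouplingHypercubicLimitRP.VolumeFirst.{diagPosHalf, IsSwapRPState, LimitSwapRP}` and the plug
into the socket is door V's `stub_socket_of_limitSwapRP`). -/

section DoorV

variable {G : Type} [Group G] [TopologicalSpace G] [IsTopologicalGroup G] [CompactSpace G]
  [MeasurableSpace G] [BorelSpace G]

/-- The CLOSED positive half of the site-diagonal mirror `x₀ ↔ x₁` on `ℤ⁴`: positively oriented links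
`(x, i)` with both endpoints in `{x₁ ≤ x₀}` (door V, verbatim). -/
def diagPosHalf : Set (Literature.MathematicalPhysics.QuantumLattice.ZdEdge 4) :=
  {e | e.1 1 ≤ e.1 0 ∧
    (e.1 + (Pi.single e.2 1 : Site 4)) (1 : Fin 4) ≤ (e.1 + (Pi.single e.2 1 : Site 4)) (0 : Fin 4)}

/-- **Swap reflection positivity of a state** `μ` on `ℤ⁴` gauge fields (mirror through SITES
`x₀ = x₁`, `Θ = configPermZd (0 1)`), door V verbatim. -/
def IsSwapRPState (μ : Measure (LGConfig 4 G)) : Prop :=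
  ∀ (F : LGConfig 4 G → ℝ) (S : Finset (Literature.MathematicalPhysics.QuantumLattice.ZdEdge 4)), (↑S : Set (Literature.MathematicalPhysics.QuantumLattice.ZdEdge 4)) ⊆ diagPosHalf →
    IsCylinder F S → Continuous F →
      0 ≤ ∫ U, F (configPermZd (Equiv.swap (0 : Fin 4) 1) U) * F U ∂μ

/-- **`LimitSwapRP r β`** (door V verbatim): every odd-torus limit state at the FIXED coupling `β` is
swap-RP. -/
def LimitSwapRP (r : LatticeRep G) (β : ℝ) : Prop :=
  ∀ μ ∈ oddTorusLimitPoints r β, IsSwapRPState μ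

end DoorV

/-! ## §1 Reflection positivity from the Markov property (abstract Nelson lemma) -/

section Nelson

variable {Ω : Type*}

/-- `m₀` **splits** `m₁` and `m₂` under `μ`, bounded-function form: conditional expectations given
`m₀` of products of a bounded `m₁`-observable and a bounded `m₂`-observable factorise. (Equivalent to
the tree's set form `CondIndepCondExp m₀ m₁ m₂ μ` by a monotone-class argument.) -/
def SplitsBdd (m₀ m₁ m₂ : MeasurableSpace Ω) {mΩ : MeasurableSpace Ω} (μ : Measure Ω) : Prop :=
  ∀ f g : Ω → ℝ, StronglyMeasurable[m₁] f → StronglyMeasurable[m₂] g →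
    (∃ C, ∀ ω, |f ω| ≤ C) → (∃ C, ∀ ω, |g ω| ≤ C) →
      μ[f * g | m₀] =ᵐ[μ] μ[f | m₀] * μ[g | m₀]

/-- A measure-preserving map fixing every `m₀`-event does not change conditional expectations
given `m₀`. -/
theorem condExp_comp_eq_of_preimage_eq {m₀ : MeasurableSpace Ω} {mΩ : MeasurableSpace Ω}
    (μ : Measure Ω) [IsFiniteMeasure μ] {θ : Ω → Ω} (hθ : MeasurePreserving θ μ μ) (hm₀ : m₀ ≤ mΩ)
    (hfix : ∀ s, MeasurableSet[m₀] s → θ ⁻¹' s = s) (F : Ω → ℝ) (hF : Integrable F μ) :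
    μ[F ∘ θ | m₀] =ᵐ[μ] μ[F | m₀] := by
  have hFθ : Integrable (F ∘ θ) μ := hθ.integrable_comp_of_integrable hF
  refine (ae_eq_condExp_of_forall_setIntegral_eq hm₀ hFθ
    (fun s _ _ => integrable_condExp.integrableOn) (fun s hs _ => ?_)
    stronglyMeasurable_condExp.aestronglyMeasurable).symm
  have hsΩ : MeasurableSet s := hm₀ s hs
  rw [setIntegral_condExp hm₀ hF hs, ← integral_indicator hsΩ, ← integral_indicator hsΩ]
  have hind : ∀ ω, s.indicator (F ∘ θ) ω = s.indicator F (θ ω) := by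
    intro ω
    have hmem : θ ω ∈ s ↔ ω ∈ s := by rw [← Set.mem_preimage, hfix s hs]
    by_cases h : ω ∈ s
    · rw [Set.indicator_of_mem h, Set.indicator_of_mem (hmem.mpr h), Function.comp_apply]
    · rw [Set.indicator_of_notMem h, Set.indicator_of_notMem (mt hmem.mp h)]
  have hfm : AEStronglyMeasurable (s.indicator F) (Measure.map θ μ) := by
    rw [hθ.map_eq]; exact (hF.indicator hsΩ).aestronglyMeasurable
  simp_rw [hind]
  rw [← integral_map hθ.measurable.aemeasurable hfm, hθ.map_eq]

/-- **Reflection positivity by the Markov property (Nelson).** If `θ` preserves `μ`, fixes every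
`m₀`-event, carries bounded `mpos`-observables to `mneg`-observables, and `m₀` splits `mneg` and `mpos`
under `μ`, then `∫ F(θω) F(ω) dμ = ∫ (μ[F | m₀])² dμ ≥ 0` for every bounded `mpos`-observable `F`.
[cite: Nelson 1973 "Quantum fields and Markoff fields"; GlimmJaffe1987 §6.1] -/
theorem integral_comp_mul_self_nonneg {m₀ mpos mneg : MeasurableSpace Ω} {mΩ : MeasurableSpace Ω}
    (μ : Measure Ω) [IsProbabilityMeasure μ] {θ : Ω → Ω} (hθ : MeasurePreserving θ μ μ)
    (hm₀ : m₀ ≤ mΩ) (hmpos : mpos ≤ mΩ)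
    (hfix : ∀ s, MeasurableSet[m₀] s → θ ⁻¹' s = s)
    (hθpos : ∀ f : Ω → ℝ, StronglyMeasurable[mpos] f → StronglyMeasurable[mneg] (f ∘ θ))
    (hM : SplitsBdd m₀ mneg mpos μ)
    (F : Ω → ℝ) (hF : StronglyMeasurable[mpos] F) (hbdd : ∃ C, ∀ ω, |F ω| ≤ C) :
    0 ≤ ∫ ω, F (θ ω) * F ω ∂μ := by
  obtain ⟨C, hC⟩ := hbdd
  have hFm : AEStronglyMeasurable F μ := (hF.mono hmpos).aestronglyMeasurable
  have hFi : Integrable F μ :=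
    ⟨hFm, HasFiniteIntegral.of_bounded (C := C)
      (Eventually.of_forall fun ω => by simpa only [Real.norm_eq_abs] using hC ω)⟩
  have h1 : ∫ ω, F (θ ω) * F ω ∂μ = ∫ ω, (μ[(F ∘ θ) * F | m₀]) ω ∂μ :=
    (integral_condExp hm₀).symm
  have h2 : μ[(F ∘ θ) * F | m₀] =ᵐ[μ] μ[F ∘ θ | m₀] * μ[F | m₀] :=
    hM (F ∘ θ) F (hθpos F hF) hF ⟨C, fun ω => hC (θ ω)⟩ ⟨C, hC⟩
  have h3 : μ[F ∘ θ | m₀] =ᵐ[μ] μ[F | m₀] := condExp_comp_eq_of_preimage_eq μ hθ hm₀ hfix F hFi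
  have h4 : μ[(F ∘ θ) * F | m₀] =ᵐ[μ] fun ω => (μ[F | m₀]) ω * (μ[F | m₀]) ω :=
    h2.trans (h3.mono fun ω hω => by rw [Pi.mul_apply, hω])
  rw [h1, integral_congr_ae h4]
  exact integral_nonneg fun ω => mul_self_nonneg _

end Nelson

/-! ## §2 The key identity: the crossing-plaquette weight is a Gaussian kernel -/

section HubbardStratonovich

variable {N : ℕ}

/-- On unitary matrices `Re tr (A Bᴴ) = N − ½ ∑ᵢⱼ |Aᵢⱼ − Bᵢⱼ|²`: the Wilson weight of a plaquette,
as a function of its two half-paths, is a Gaussian kernel in the ambient matrix space (the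
Hilbert–Schmidt norm is CONSTANT on the unitary group). Hence (Gaussian convolution)
`exp(β Re tr(A Bᴴ)) = c(β,N) ∫ exp(−β‖A − c‖²_F) exp(−β‖B − c‖²_F) dc` over `M_N(ℂ) ≅ ℝ^{2N²}` —
one auxiliary Gaussian matrix per crossing plaquette decouples the two half-paths with POSITIVE
weights (Hubbard–Stratonovich). -/
theorem re_trace_mul_star_eq (A B : Matrix (Fin N) (Fin N) ℂ)
    (hA : A ∈ Matrix.unitaryGroup (Fin N) ℂ) (hB : B ∈ Matrix.unitaryGroup (Fin N) ℂ) :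
    (A * star B).trace.re = N - (1 / 2 : ℝ) * ∑ i, ∑ j, ‖A i j - B i j‖ ^ 2 := by
  have hrow : ∀ M : Matrix (Fin N) (Fin N) ℂ, M ∈ Matrix.unitaryGroup (Fin N) ℂ →
      ∀ i, ∑ j, Complex.normSq (M i j) = 1 := by
    intro M hM i
    have h := Matrix.mem_unitaryGroup_iff.mp hM
    have hii := congrFun (congrFun h i) i
    rw [Matrix.mul_apply, Matrix.one_apply_eq] at hii
    have hc : ∑ j, (Complex.normSq (M i j) : ℂ) = 1 := by
      rw [← hii]
      refine Finset.sum_congr rfl fun j _ => ?_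
      rw [Matrix.star_apply, Complex.star_def, Complex.mul_conj]
    exact_mod_cast hc
  have htr : (A * star B).trace.re = ∑ i, ∑ j, (A i j * (starRingEnd ℂ) (B i j)).re := by
    simp only [Matrix.trace, Matrix.diag_apply, Matrix.mul_apply, Matrix.star_apply,
      Complex.star_def, Complex.re_sum]
  have hsq : ∀ i j, ‖A i j - B i j‖ ^ 2 =
      Complex.normSq (A i j) + Complex.normSq (B i j) - 2 * (A i j * (starRingEnd ℂ) (B i j)).re := by
    intro i j
    rw [Complex.sq_norm, Complex.normSq_sub]
  rw [htr]
  have hinner : ∀ i, ∑ j, ‖A i j - B i j‖ ^ 2 =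
      2 - 2 * ∑ j, (A i j * (starRingEnd ℂ) (B i j)).re := by
    intro i
    rw [Finset.sum_congr rfl fun j _ => hsq i j, Finset.sum_sub_distrib, Finset.sum_add_distrib,
      hrow A hA i, hrow B hB i, ← Finset.mul_sum]
    norm_num
  rw [Finset.sum_congr rfl fun i _ => hinner i, Finset.sum_sub_distrib, ← Finset.mul_sum,
    Finset.sum_const, Finset.card_univ, Fintype.card_fin, nsmul_eq_mul]
  ring

end HubbardStratonovich

/-! ## §3 The letter: global Markov property of the Hubbard–Stratonovich extension across `x₀ = x₁` -/

section Letter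

variable {G : Type} [Group G] [TopologicalSpace G] [IsTopologicalGroup G] [CompactSpace G]
  [MeasurableSpace G] [BorelSpace G]

/-- The positive half-path `x → x + e₀ → x + e₀ + e₁` of the `(0,1)`-plaquette at `x`. -/
def pathPlus (U : LGConfig 4 G) (x : Site 4) : G := U (x, 0) * U (x + Pi.single 0 1, 1)

/-- The negative half-path `x → x + e₁ → x + e₁ + e₀` of the `(0,1)`-plaquette at `x`. -/
def pathMinus (U : LGConfig 4 G) (x : Site 4) : G := U (x, 1) * U (x + Pi.single 1 1, 0)

omit [TopologicalSpace G] [IsTopologicalGroup G] [CompactSpace G] [MeasurableSpace G]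
  [BorelSpace G] in
/-- The `(0,1)`-plaquette holonomy is `W₊ W₋⁻¹`. -/
theorem plaquetteHolonomyZd_zero_one (U : LGConfig 4 G) (x : Site 4) :
    plaquetteHolonomyZd U x 0 1 = pathPlus U x * (pathMinus U x)⁻¹ := by
  simp [plaquetteHolonomyZd, pathPlus, pathMinus, mul_assoc]

/-- Index of the auxiliary real Gaussian coordinates: one complex `N × N` matrix (`Fin 2` = re/im)
per base site `x` of a `(0,1)`-plaquette. -/
abbrev AuxIndex (N : ℕ) : Type := Site 4 × (Fin N × Fin N) × Fin 2

/-- Auxiliary configurations and EXTENDED configurations `(U, c)`. -/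
abbrev AuxConfig (N : ℕ) : Type := AuxIndex N → ℝ

/-- Extended configurations: gauge field plus auxiliary Gaussian matrices. -/
abbrev ExtConfig (G : Type) (N : ℕ) : Type := LGConfig 4 G × AuxConfig N

/-- Mean of the auxiliary coordinate `(x, (i,j), s)` given `U`: the `(i,j)` entry of
`(ρ(W₊(x)) + ρ(W₋(x)))/2`, real (`s = 0`) or imaginary (`s = 1`) part. -/
def hsMean (r : LatticeRep G) (U : LGConfig 4 G) (idx : AuxIndex r.N) : ℝ :=
  let z : ℂ := ((r.ρ (pathPlus U idx.1)) idx.2.1.1 idx.2.1.2 +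
    (r.ρ (pathMinus U idx.1)) idx.2.1.1 idx.2.1.2) / 2
  if idx.2.2 = 0 then z.re else z.im

/-- Variance `1/(4β)` of each auxiliary real coordinate (density `∝ exp(−2β |c − mean|²)`). -/
def hsVar (β : ℝ) : ℝ≥0 := Real.toNNReal (1 / (4 * β))

/-- The Hubbard–Stratonovich kernel: given `U`, the auxiliary coordinates are independent real
Gaussians (Mathlib `gaussianReal`, `Measure.infinitePi`). -/
def hsKernel (r : LatticeRep G) (β : ℝ) (U : LGConfig 4 G) : Measure (AuxConfig r.N) :=
  Measure.infinitePi fun idx : AuxIndex r.N => gaussianReal (hsMean r U idx) (hsVar β)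

/-- The **Hubbard–Stratonovich extension** `μ̂` of a state `μ` on `ℤ⁴` gauge fields: `U ∼ μ`, then
`c ∼ hsKernel r β U`. Its `U`-marginal is `μ`; for a Wilson DLR state it is a DLR state of the
extended (links + auxiliary matrices) specification, which is nearest-neighbour in `v = x₀ − x₁`. -/
def hsExtension (r : LatticeRep G) (β : ℝ) (μ : Measure (LGConfig 4 G)) :
    Measure (ExtConfig G r.N) :=
  μ.bind fun U => (hsKernel r β U).map fun c => (U, c)

/-- The CLOSED negative half of the site-diagonal mirror: links with both endpoints in `{x₀ ≤ x₁}`. -/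
def diagNegHalf : Set (Literature.MathematicalPhysics.QuantumLattice.ZdEdge 4) :=
  {e | e.1 0 ≤ e.1 1 ∧
    (e.1 + (Pi.single e.2 1 : Site 4)) (0 : Fin 4) ≤ (e.1 + (Pi.single e.2 1 : Site 4)) (1 : Fin 4)}

/-- Links lying IN the mirror hyperplane `x₀ = x₁` (both endpoints on it: directions `2, 3`). -/
def mirrorEdges : Set (Literature.MathematicalPhysics.QuantumLattice.ZdEdge 4) := diagPosHalf ∩ diagNegHalf

/-- The σ-algebra of extended configurations generated by the links in `E` and the auxiliary
coordinates based at sites in `A`. -/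
@[reducible] def extSigma (N : ℕ) (E : Set (Literature.MathematicalPhysics.QuantumLattice.ZdEdge 4)) (A : Set (Site 4)) : MeasurableSpace (ExtConfig G N) :=
  MeasurableSpace.comap
    (fun ω : ExtConfig G N => (fun e : E => ω.1 e, fun idx : {idx : AuxIndex N // idx.1 ∈ A} => ω.2 idx))
    inferInstance

/-- `𝒜̂₊`: closed positive half — links of `diagPosHalf`, auxiliary matrices at sites `x₁ ≤ x₀`. -/
@[reducible] def extPos (N : ℕ) : MeasurableSpace (ExtConfig G N) := extSigma N diagPosHalf {x | x 1 ≤ x 0}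

/-- `𝒜̂₋`: closed negative half. -/
@[reducible] def extNeg (N : ℕ) : MeasurableSpace (ExtConfig G N) := extSigma N diagNegHalf {x | x 0 ≤ x 1}

/-- `𝒜̂₀`: the MIRROR data — in-plane links and auxiliary matrices at mirror sites; fixed
pointwise by the swap. -/
@[reducible] def extMirror (N : ℕ) : MeasurableSpace (ExtConfig G N) := extSigma N mirrorEdges {x | x 0 = x 1}

/-- **LETTER (door M)** — `DiagGlobalMarkov r β μ`: the Hubbard–Stratonovich extension of `μ` has the
GLOBAL MARKOV PROPERTY across the diagonal hyperplane `x₀ = x₁`: the mirror data split the two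
closed halves (tree `CondIndepCondExp`). Intrinsic to `μ` (no second volume family, no
identification, no transfer operator), qualitative, gap-blind, and an ALMOST-SURE statement in the
mirror data. -/
def DiagGlobalMarkov (r : LatticeRep G) (β : ℝ) (μ : Measure (LGConfig 4 G)) : Prop :=
  CondIndepCondExp (extMirror (G := G) r.N) (extNeg (G := G) r.N) (extPos (G := G) r.N)
    (hsExtension r β μ)

/-- The swap `x₀ ↔ x₁` on extended configurations: `configPermZd (0 1)` on links, relabelling of
the auxiliary matrices by the site swap (the Gaussian mean `(ρW₊ + ρW₋)/2` is swap-symmetric). -/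
def extSwap (N : ℕ) (ω : ExtConfig G N) : ExtConfig G N :=
  (configPermZd (Equiv.swap (0 : Fin 4) 1) ω.1,
    fun idx => ω.2 (sitePermZd (Equiv.swap (0 : Fin 4) 1) idx.1, idx.2))

/-- **TARGET SIGNATURE (size M; NOT proved here).** At `β > 0`: if every odd-torus limit state at
coupling `β` has the diagonal global Markov property, then every such state is swap-RP
(`LimitSwapRP`, door V's plug). Proof plan: odd-torus limits are swap-invariant
(`IsInfiniteVolumeLimitAlong.map_configPermZd`), hence `μ̂` is `extSwap`-invariant; `extSwap` fixes
every `extMirror`-event and carries `extPos`-observables to `extNeg`-observables; a continuous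
cylinder observable of `diagPosHalf` composed with `Prod.fst` is a bounded `extPos`-observable; §1. -/
theorem stub_limitSwapRP_of_limitDiagGlobalMarkov (r : LatticeRep G) {β : ℝ} (hβ : 0 < β)
    (h : ∀ μ ∈ oddTorusLimitPoints r β, DiagGlobalMarkov r β μ) : LimitSwapRP r β := by
  sorry

end Letter

end Summit.QuantumFields.YangMills.Cruxes.WeakCouplingHypercubicLimitRP.GlobalMarkov

end
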